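import Summits.QuantumFields.QCD.Theses.EulerDescent
import Summits.QuantumFields.QCD.Theorems.GapBuysCauchyRateRotationRestorationLatticeInvariancePassesToLimit
import Literature.MathematicalPhysics.QuantumFieldTheory.QCDCalibratedSpecies
import Literature.MathematicalPhysics.QuantumFieldTheory.OSData
import HarnessLib

/-!
# Rotation inheritance of lattice limits from an E1-invariant limit family
(helper of stub `stub_heavyCalibration`, line `vitali-mass-descent`, crux
`Summit.QuantumFields.QCD.Theses.EulerDescent.RetypedContinuumComplement`, item stmt-QuantumFields-16903)

The skeleton's `RotationsInheritedAt 𝒞 m` asks, for every off-diagonal real tensor tuple `f`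
(`IsTensorOf F (ofRealTest ∘ f)`, `IsOffDiagonal F`) and every proper rotation `R` of `ℝ⁴`, that the
`k → ∞` limits `c`, `c'` (when they exist) of the lattice `n`-point functions of `f` and of the rotated
tuple `fᵢ ∘ R⁻¹` (`linActTest R (f i)`) agree.  This file proves the HEAVY half of that clause in the
only way the heavy body can give it: if the lattice `n`-point functions of a scheme `sch` CONVERGE on
off-diagonal real tensors to a labelled Schwinger family `S` which is invariant under proper
rotations on `⁰𝒮` (clause 2 of `LabelledSchwingerFamily.IsEuclideanInvariant`; for OS data `T` it is
the FIELD `T.invariant.2`), then rotations are inherited at the level of lattice limits —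
`rotationsInherited_of_tendsto_invariant` (any scheme), `rotationsInheritedAt_of_tendsto_invariant`
(the calibrated scheme `𝒞.scheme m`, conclusion = `RotationsInheritedAt 𝒞 m` unfolded),
`rotationsInheritedAt_of_tendsto_osData` / `rotationsInheritedAt_of_isQCDAlong` (OS data, resp. the
`IsQCDAlong` clause of the heavy body).

Proof: uniqueness of limits in `ℂ` (`tendsto_nhds_unique`), the rotated tuple is again an
off-diagonal real tensor tuple (`isTensorOf_linActMulti_ofRealTest`, `isOffDiagonal_linActMulti` of
`RotationRestoration.Birth.LatticeInvariancePassesToLimit`), and `S n σ (linActMulti R F) = S n σ F`.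
Def-free theorem file. [folklore]
-/

noncomputable section

namespace Summit.QuantumFields.QCD.Cruxes.RetypedContinuumComplement.VitaliMassDescent

open Filter Topology
open Literature.MathematicalPhysics.AQFT Literature.MathematicalPhysics.QuantumLattice
  Literature.MathematicalPhysics.QuantumFieldTheory
open Summit.QuantumFields.QCD.Cruxes.RotationRestoration.Birth.LatticeInvariancePassesToLimit
  (isOffDiagonal_linActMulti isTensorOf_linActMulti_ofRealTest)

variable {Nf : ℕ}

/-- **Rotation inheritance of lattice limits, any scheme.**  If the lattice `n`-point functions
(`n ≥ 1`) of `sch` converge on off-diagonal real tensors to a labelled family `S` invariant under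
proper rotations on `⁰𝒮`, then for every off-diagonal real tensor tuple `f`, every proper rotation
`R` and all limits `c` of the functions of `f` and `c'` of the functions of the rotated tuple
`fᵢ ∘ R⁻¹`, `c' = c`. [folklore] -/
theorem rotationsInherited_of_tendsto_invariant (sch : QCDScheme Nf)
    (S : LabelledSchwingerFamily (QCDField Nf) (EuclideanSpace ℝ (Fin 4)))
    (hrot : ∀ (n : ℕ) (σ : Fin n → QCDField Nf)
      (R : EuclideanSpace ℝ (Fin 4) ≃ₗᵢ[ℝ] EuclideanSpace ℝ (Fin 4)),
      LinearMap.det (R.toLinearEquiv : EuclideanSpace ℝ (Fin 4) →ₗ[ℝ] EuclideanSpace ℝ (Fin 4)) = 1 →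
        ∀ F : SchwartzMap (Fin n → EuclideanSpace ℝ (Fin 4)) ℂ, IsOffDiagonal F →
          S n σ (linActMulti R F) = S n σ F)
    (hS : ∀ n : ℕ, n ≠ 0 → ∀ (σ : Fin n → QCDField Nf)
      (f : Fin n → SchwartzMap (EuclideanSpace ℝ (Fin 4)) ℝ)
      (F : SchwartzMap (Fin n → EuclideanSpace ℝ (Fin 4)) ℂ),
      IsTensorOf F (fun i => ofRealTest (f i)) → IsOffDiagonal F →
        Filter.Tendsto (fun k : ℕ => qcdLatticeSchwinger sch k n σ f) Filter.atTop (nhds (S n σ F))) :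
    ∀ n : ℕ, n ≠ 0 → ∀ (σ : Fin n → QCDField Nf) (f : Fin n → SchwartzMap (EuclideanSpace ℝ (Fin 4)) ℝ)
      (F : SchwartzMap (Fin n → EuclideanSpace ℝ (Fin 4)) ℂ),
      IsTensorOf F (fun i => ofRealTest (f i)) → IsOffDiagonal F →
        ∀ R : EuclideanSpace ℝ (Fin 4) ≃ₗᵢ[ℝ] EuclideanSpace ℝ (Fin 4),
          LinearMap.det (R.toLinearEquiv : EuclideanSpace ℝ (Fin 4) →ₗ[ℝ] EuclideanSpace ℝ (Fin 4)) = 1 →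
          ∀ c c' : ℂ,
            Filter.Tendsto (fun k : ℕ => qcdLatticeSchwinger sch k n σ f) Filter.atTop (nhds c) →
            Filter.Tendsto (fun k : ℕ => qcdLatticeSchwinger sch k n σ
              (fun i => linActTest (𝕜 := ℝ) R (f i))) Filter.atTop (nhds c') → c' = c := by
  intro n hn σ f F hT hO R hR c c' hc hc'
  have hT' : IsTensorOf (linActMulti R F) (fun i => ofRealTest (linActTest (𝕜 := ℝ) R (f i))) :=
    isTensorOf_linActMulti_ofRealTest R hT
  have hO' : IsOffDiagonal (linActMulti R F) := isOffDiagonal_linActMulti R hO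
  have h₁ : c = S n σ F := tendsto_nhds_unique hc (hS n hn σ f F hT hO)
  have h₂ : c' = S n σ (linActMulti R F) :=
    tendsto_nhds_unique hc' (hS n hn σ (fun i => linActTest (𝕜 := ℝ) R (f i)) (linActMulti R F) hT' hO')
  rw [h₁, h₂, hrot n σ R hR F hO]

/-- **Rotation inheritance at `m` for a calibrated family** (conclusion = the skeleton's
`RotationsInheritedAt 𝒞 m`, unfolded): if the calibrated lattice functions at the tuple `m` converge
on off-diagonal real tensors to a labelled family `S` invariant under proper rotations on `⁰𝒮`, the
limits of every tuple and of its proper rotates agree. [folklore] -/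
theorem rotationsInheritedAt_of_tendsto_invariant {reg : QCDRegularisation Nf}
    (𝒞 : CalibratedSpeciesFamily reg) (m : Fin Nf → ℝ)
    (S : LabelledSchwingerFamily (QCDField Nf) (EuclideanSpace ℝ (Fin 4)))
    (hrot : ∀ (n : ℕ) (σ : Fin n → QCDField Nf)
      (R : EuclideanSpace ℝ (Fin 4) ≃ₗᵢ[ℝ] EuclideanSpace ℝ (Fin 4)),
      LinearMap.det (R.toLinearEquiv : EuclideanSpace ℝ (Fin 4) →ₗ[ℝ] EuclideanSpace ℝ (Fin 4)) = 1 →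
        ∀ F : SchwartzMap (Fin n → EuclideanSpace ℝ (Fin 4)) ℂ, IsOffDiagonal F →
          S n σ (linActMulti R F) = S n σ F)
    (hS : ∀ n : ℕ, n ≠ 0 → ∀ (σ : Fin n → QCDField Nf)
      (f : Fin n → SchwartzMap (EuclideanSpace ℝ (Fin 4)) ℝ)
      (F : SchwartzMap (Fin n → EuclideanSpace ℝ (Fin 4)) ℂ),
      IsTensorOf F (fun i => ofRealTest (f i)) → IsOffDiagonal F →
        Filter.Tendsto (fun k : ℕ => qcdLatticeSchwinger (𝒞.scheme m) k n σ f) Filter.atTop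
          (nhds (S n σ F))) :
    ∀ n : ℕ, n ≠ 0 → ∀ (σ : Fin n → QCDField Nf) (f : Fin n → SchwartzMap (EuclideanSpace ℝ (Fin 4)) ℝ)
      (F : SchwartzMap (Fin n → EuclideanSpace ℝ (Fin 4)) ℂ),
      IsTensorOf F (fun i => ofRealTest (f i)) → IsOffDiagonal F →
        ∀ R : EuclideanSpace ℝ (Fin 4) ≃ₗᵢ[ℝ] EuclideanSpace ℝ (Fin 4),
          LinearMap.det (R.toLinearEquiv : EuclideanSpace ℝ (Fin 4) →ₗ[ℝ] EuclideanSpace ℝ (Fin 4)) = 1 →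
          ∀ c c' : ℂ,
            Filter.Tendsto (fun k : ℕ => qcdLatticeSchwinger (𝒞.scheme m) k n σ f) Filter.atTop (nhds c) →
            Filter.Tendsto (fun k : ℕ => qcdLatticeSchwinger (𝒞.scheme m) k n σ
              (fun i => linActTest (𝕜 := ℝ) R (f i))) Filter.atTop (nhds c') → c' = c :=
  rotationsInherited_of_tendsto_invariant (𝒞.scheme m) S hrot hS

/-- **Rotation inheritance at `m` from convergence to OS data.**  If the calibrated lattice
functions at `m` converge on off-diagonal real tensors to the Schwinger functions of OS data `T`,
then rotations are inherited at `m`: E1 is a FIELD of `T` (`T.invariant.2`). [folklore] -/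
theorem rotationsInheritedAt_of_tendsto_osData {reg : QCDRegularisation Nf}
    (𝒞 : CalibratedSpeciesFamily reg) (m : Fin Nf → ℝ) (T : OSData (QCDField Nf) 4)
    (hS : ∀ n : ℕ, n ≠ 0 → ∀ (σ : Fin n → QCDField Nf)
      (f : Fin n → SchwartzMap (EuclideanSpace ℝ (Fin 4)) ℝ)
      (F : SchwartzMap (Fin n → EuclideanSpace ℝ (Fin 4)) ℂ),
      IsTensorOf F (fun i => ofRealTest (f i)) → IsOffDiagonal F →
        Filter.Tendsto (fun k : ℕ => qcdLatticeSchwinger (𝒞.scheme m) k n σ f) Filter.atTop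
          (nhds (T.schwinger n σ F))) :
    ∀ n : ℕ, n ≠ 0 → ∀ (σ : Fin n → QCDField Nf) (f : Fin n → SchwartzMap (EuclideanSpace ℝ (Fin 4)) ℝ)
      (F : SchwartzMap (Fin n → EuclideanSpace ℝ (Fin 4)) ℂ),
      IsTensorOf F (fun i => ofRealTest (f i)) → IsOffDiagonal F →
        ∀ R : EuclideanSpace ℝ (Fin 4) ≃ₗᵢ[ℝ] EuclideanSpace ℝ (Fin 4),
          LinearMap.det (R.toLinearEquiv : EuclideanSpace ℝ (Fin 4) →ₗ[ℝ] EuclideanSpace ℝ (Fin 4)) = 1 →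
          ∀ c c' : ℂ,
            Filter.Tendsto (fun k : ℕ => qcdLatticeSchwinger (𝒞.scheme m) k n σ f) Filter.atTop (nhds c) →
            Filter.Tendsto (fun k : ℕ => qcdLatticeSchwinger (𝒞.scheme m) k n σ
              (fun i => linActTest (𝕜 := ℝ) R (f i))) Filter.atTop (nhds c') → c' = c :=
  rotationsInheritedAt_of_tendsto_invariant 𝒞 m T.schwinger T.invariant.2 hS

/-- **Rotation inheritance at `m` from the `IsQCDAlong` clause of the heavy body.**  If the
calibrated scheme `𝒞.scheme m` IS QCD along OS data `T` (`IsQCDAlong (𝒞.scheme m) T`, whose third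
field is convergence on off-diagonal real tensors to `T.schwinger`), rotations are inherited at `m`.
[folklore] -/
theorem rotationsInheritedAt_of_isQCDAlong {reg : QCDRegularisation Nf}
    (𝒞 : CalibratedSpeciesFamily reg) (m : Fin Nf → ℝ) (T : OSData (QCDField Nf) 4)
    (h : IsQCDAlong (𝒞.scheme m) T) :
    ∀ n : ℕ, n ≠ 0 → ∀ (σ : Fin n → QCDField Nf) (f : Fin n → SchwartzMap (EuclideanSpace ℝ (Fin 4)) ℝ)
      (F : SchwartzMap (Fin n → EuclideanSpace ℝ (Fin 4)) ℂ),
      IsTensorOf F (fun i => ofRealTest (f i)) → IsOffDiagonal F →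
        ∀ R : EuclideanSpace ℝ (Fin 4) ≃ₗᵢ[ℝ] EuclideanSpace ℝ (Fin 4),
          LinearMap.det (R.toLinearEquiv : EuclideanSpace ℝ (Fin 4) →ₗ[ℝ] EuclideanSpace ℝ (Fin 4)) = 1 →
          ∀ c c' : ℂ,
            Filter.Tendsto (fun k : ℕ => qcdLatticeSchwinger (𝒞.scheme m) k n σ f) Filter.atTop (nhds c) →
            Filter.Tendsto (fun k : ℕ => qcdLatticeSchwinger (𝒞.scheme m) k n σ
              (fun i => linActTest (𝕜 := ℝ) R (f i))) Filter.atTop (nhds c') → c' = c :=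
  rotationsInheritedAt_of_tendsto_osData 𝒞 m T h.2.2

end Summit.QuantumFields.QCD.Cruxes.RetypedContinuumComplement.VitaliMassDescent

end
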